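import Mathlib
import Summits.AnomalousDissipation.AnomalousDissipation.Theorems.ConeDesingularisation.Negative.FluxTransfer
import Summits.AnomalousDissipation.AnomalousDissipation.Theorems.ConeDesingularisation.Negative.LogMeanFlux
import Summits.AnomalousDissipation.AnomalousDissipation.Theorems.ConeDesingularisation.Negative.LpEscape
import Summits.AnomalousDissipation.AnomalousDissipation.Theorems.PointSinkConeDesingularisationStubC1ConeFluxless
import Summits.AnomalousDissipation.AnomalousDissipation.Theorems.PointSinkConeDesingularisationStubDssFluxRigidity

/-!
# Negative knowledge for the crux `ConeDesingularisation` (stmt-AnomalousDissipation-19034 ↔ 19036):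
# V. Flux transfer — an `L³ × L^{3/2}`-fed cone is an inward point-flux cone of strength exactly `D`

Route `PointSink` of `AnomalousDissipation`, crux `ConeDesingularisation ↔ CascadeSoliton`
(`coneDesingularisation_iff_cascadeSoliton`). A *cascade soliton* is a smooth steady unit-viscosity
Navier–Stokes solution `(Q, P)` on `ℝ³` with the `R^{5/3}` mass envelope and dissipation
`D = ∫ |∇Q|² > 0`, asymptotic at infinity, in `L²` on the geometric shells `λ^k < ‖x‖ < λ^{k+1}`,
to a discretely self-similar cone `V` of degree `−2/3`. The route's own mechanism
(`PointSinkSolitonTransplantCoreEnergyFlux`) says that along the exact blow-down (core) family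
`Q_j = (λ^j)^{2/3} Q(λ^j ·)` — Navier–Stokes with viscosity `(λ^j)^{-1/3} → 0` and dissipation exactly
`D` concentrating at the origin — the inward cubic energy flux through any fixed smooth cutoff tends
to `D`. This file transfers that flux **to the cone** as soon as the matching is strong enough to
pass to the limit in the cubic flux, and evaluates it in closed form.

## Results (all sorry-free; `[folklore]` = routine real analysis, no printed source needed)

* `flux_pairing_tendsto` (§2): continuity of the cubic flux pairing
  `(u, p) ↦ ∫ (½‖u‖² + p) w[u]` under `u → V` in `L³(A)`, `p → Π` in `L^{3/2}(A)` on a bounded set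
  `A` carrying the continuous compactly supported test field `w` (Hölder `(3, 3/2)`, §1).
* `fedCone_smoothFlux_eq_dissipation` (§4, **flux transfer**): if `(Q, P)` is matched to a DSS pair
  `(V, Π)` (`V` of degree `−2/3`, `Π` of degree `−4/3`, `‖V‖², ‖V‖³, |Π|^{3/2} ∈ L¹_loc(ℝ³∖0)`) in
  `L²` (the `CascadeSoliton` clause), in `L³` — `(λ^k)⁻¹ ∫_{shell k} ‖Q − V‖³ → 0` — and in `L^{3/2}`
  for the pressure — `(λ^k)⁻¹ ∫_{shell k} |P − Π|^{3/2} → 0` —, then for every smooth radial-shell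
  cutoff `ψ` (`ψ = 1` on `‖x‖ < r`, `r > 1`; `ψ = 0` on `‖x‖ > b`, `b < λ²`):
  `∫ (½‖V‖² + Π) Dψ[V] = D`.
* `logMeanFlux_eq_of_constantSmoothFlux` (§5): for any such DSS pair, a `c`-independent smooth flux
  `τ` through the dilates `G(‖x‖²/c²)`, `c ∈ [1, λ]`, of one radial profile forces the **sharp**
  log-mean flux law `∫_{1<‖x‖<λ} (½‖V‖² + Π) ⟪V, x⟫/‖x‖² = −τ log λ` (Fubini average in `c`,
  the inner `c`-integral in closed form, exact `λ⁻³`-covariance of the flux density).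
* `tendsto_shellL2_of_shellL3` (§6): `L³` shell matching implies the `L²` shell matching of
  `CascadeSoliton` (Hölder on the shells), so "fed in `L³ × L^{3/2}`" is a strengthening of the crux's
  far-field clause, not an extra structure.
* `fedCone_logMeanFlux_eq` (§6, **headline**): an `L³ × L^{3/2}`-fed cone satisfies
  `∫_{1<‖x‖<λ} (½‖V‖² + Π) ⟪V, x⟫/‖x‖² = −D log λ` — it is an inward point-flux cone of strength
  exactly `D`, i.e. precisely the (proved, but only by a *fluxless* degenerate witness) statement
  `PointFluxCone` with `ε = D > 0` forced.
* `not_cascadeSoliton_L3fedBy_c1EulerCone` (§6): hence **no `C¹` classical Euler cone** (Landau-type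
  or smooth DSS profile) can be the `L³ × L^{3/2}` far field of a cascade soliton
  (`stub_c1ConeFluxless`: such cones are fluxless) — unconditional.
* `not_cascadeSoliton_L3fedBy_renormalisedCone` (§6): nor can any measurable DSS cone satisfying
  the renormalised local energy balance off the origin (`stub_dssFluxRigidity`), e.g. any weak Euler
  cone that is a strong `L³_loc` limit (DiPerna–Lions).

## Reading for the crux (refuter's note)

`CascadeSoliton` as filed asks only for `L²` shell matching, under which the cubic flux need not
pass to the limit; the natural strengthening in which the cone actually *carries* the cascade
(`L³ × L^{3/2}` matching, the Onsager/Duchon–Robert class in which energy flux is defined) is hereby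
reduced to: the cone must be an irregular (non-renormalisable off the apex) dissipative Euler
solution on `ℝ³∖0` with inward apex flux exactly `D` on every fundamental shell. No such steady DSS
Euler solution is known; the only `PointFluxCone` witness in the tree is fluxless. Conversely, for
the statement as filed (`L²` matching only) the flux identity is lost in the limit, and the far
field carries no computable trace of `D` — which is why no Liouville theorem in the `R^{5/3}`/DSS
class is available (see `LpEscape`, `FarFieldMass`, `LiouvilleReduction`).

Dependencies: the route's `PointSinkSolitonTransplant{CoreEnergyFlux,StubSolitonCoreFamily}`,
`PointSinkConeDesingularisationStub{C1ConeFluxless,DssFluxRigidity}`, `Negative/LpEscape`;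
`Literature.Analysis.FluidPDE.{SelfSimilarEulerConeEnergy,DuchonRobertShellLaw,EulerReynoldsLadderGluingLimit}`.
-/


-- `Summit.<Summit>.<Problem>` is the tree's mandated summit-side namespace (CONVENTIONS §2).
set_option linter.dupNamespace false

noncomputable section

namespace Summit.AnomalousDissipation.AnomalousDissipation.Theorems.ConeDesingularisation.Negative

open MeasureTheory Filter Topology Set Metric
open scoped InnerProductSpace ContDiff
open Literature.Analysis.FluidPDE.EulerReynoldsLadder (isCompact_shell shell_subset_ne_zero)
open Literature.Analysis.FunctionSpaces Literature.Analysis.FluidPDE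
open Summit.AnomalousDissipation.AnomalousDissipation.Theorems

/-! ### §6 The fed cone is an inward point-flux cone of strength exactly `D`; corollaries -/

/-- `‖V‖² ≤ 1 + ‖V‖³`, so `‖V‖³ ∈ L¹_loc(ℝ³∖0)` gives `‖V‖² ∈ L¹_loc(ℝ³∖0)`. [folklore] -/
theorem locallyIntegrableOn_normSq_of_cube {V : EuclideanSpace ℝ (Fin 3) → EuclideanSpace ℝ (Fin 3)}
    (hVm : AEStronglyMeasurable V volume)
    (hV3 : LocallyIntegrableOn (fun x => ‖V x‖ ^ 3) {x : EuclideanSpace ℝ (Fin 3) | x ≠ 0} volume) :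
    LocallyIntegrableOn (fun x => ‖V x‖ ^ 2) {x : EuclideanSpace ℝ (Fin 3) | x ≠ 0} volume := by
  intro x hx
  obtain ⟨U, hU, hint⟩ := hV3 x hx
  refine ⟨U ∩ ball x 1, Filter.inter_mem hU (mem_nhdsWithin_of_mem_nhds (ball_mem_nhds x one_pos)), ?_⟩
  have hfin : volume (U ∩ ball x 1) < ⊤ :=
    (Metric.isBounded_ball.subset Set.inter_subset_right).measure_lt_top
  haveI : IsFiniteMeasure (volume.restrict (U ∩ ball x 1)) := ⟨by rwa [Measure.restrict_apply_univ]⟩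
  have hW3 : IntegrableOn (fun x => ‖V x‖ ^ 3) (U ∩ ball x 1) volume := hint.mono_set Set.inter_subset_left
  refine Integrable.mono' ((integrable_const (1 : ℝ)).add hW3) (hVm.norm.pow 2).restrict
    (Eventually.of_forall fun y => ?_)
  rw [Real.norm_eq_abs, abs_of_nonneg (by positivity)]
  show ‖V y‖ ^ 2 ≤ 1 + ‖V y‖ ^ 3
  rcases le_or_gt ‖V y‖ 1 with h | h
  · nlinarith [norm_nonneg (V y), pow_le_one₀ (norm_nonneg (V y)) h (n := 2)]
  · nlinarith [norm_nonneg (V y)]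

/-- `L³` shell matching at rate `(λ^k)⁻¹ ∫_{shell k} ‖f‖³ → 0` implies the `L²` shell matching of
`CascadeSoliton`, `(λ^k)^{-5/3} ∫_{shell k} ‖f‖² → 0` (Hölder on the shell, `vol(shell k) = λ^{3k} v₀`).
[folklore] -/
theorem tendsto_shellL2_of_shellL3 {lam : ℝ} (hlam : 1 < lam)
    {f : EuclideanSpace ℝ (Fin 3) → EuclideanSpace ℝ (Fin 3)} (hfm : AEStronglyMeasurable f volume)
    (hf3 : ∀ k : ℕ, IntegrableOn (fun x => ‖f x‖ ^ 3)
      {x : EuclideanSpace ℝ (Fin 3) | lam ^ k < ‖x‖ ∧ ‖x‖ < lam ^ (k + 1)} volume)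
    (h : Tendsto (fun k : ℕ => (lam ^ k)⁻¹ *
      ∫ x in {x : EuclideanSpace ℝ (Fin 3) | lam ^ k < ‖x‖ ∧ ‖x‖ < lam ^ (k + 1)}, ‖f x‖ ^ 3)
      atTop (𝓝 0)) :
    Tendsto (fun k : ℕ => (lam ^ k) ^ (-(5 / 3 : ℝ)) *
      ∫ x in {x : EuclideanSpace ℝ (Fin 3) | lam ^ k < ‖x‖ ∧ ‖x‖ < lam ^ (k + 1)}, ‖f x‖ ^ 2)
      atTop (𝓝 0) := by
  have hlam0 : 0 < lam := one_pos.trans hlam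
  set v₀ : ℝ := volume.real {x : EuclideanSpace ℝ (Fin 3) | 1 < ‖x‖ ∧ ‖x‖ < lam} with hv₀
  have hv₀0 : 0 ≤ v₀ := measureReal_nonneg
  have hmaj : Tendsto (fun k : ℕ => v₀ ^ (1 / 3 : ℝ) * ((lam ^ k)⁻¹ *
      ∫ x in {x : EuclideanSpace ℝ (Fin 3) | lam ^ k < ‖x‖ ∧ ‖x‖ < lam ^ (k + 1)}, ‖f x‖ ^ 3) ^
        (2 / 3 : ℝ)) atTop (𝓝 0) := by
    have h1 := h.rpow_const (p := (2 / 3 : ℝ)) (Or.inr (by norm_num))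
    rw [Real.zero_rpow (by norm_num)] at h1
    simpa using h1.const_mul (v₀ ^ (1 / 3 : ℝ))
  refine squeeze_zero (fun k => mul_nonneg (Real.rpow_nonneg (pow_nonneg hlam0.le _) _)
    (integral_nonneg fun _ => by positivity)) (fun k => ?_) hmaj
  have hLk : 0 < lam ^ k := pow_pos hlam0 k
  set A : Set (EuclideanSpace ℝ (Fin 3)) :=
    {x : EuclideanSpace ℝ (Fin 3) | lam ^ k < ‖x‖ ∧ ‖x‖ < lam ^ (k + 1)} with hA
  have hAm : MeasurableSet A := measurableSet_shell _ _
  have hAfin : volume A < ⊤ := (isBounded_shell _ _).measure_lt_top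
  haveI : IsFiniteMeasure (volume.restrict A) := ⟨by rwa [Measure.restrict_apply_univ]⟩
  have hI0 : 0 ≤ ∫ x in A, ‖f x‖ ^ 3 := integral_nonneg fun _ => by positivity
  -- Hölder `(3, 3/2)` with `1 · ‖f‖²`
  have hg32 : Integrable (fun x => (‖f x‖ ^ 2) ^ (3 / 2 : ℝ)) (volume.restrict A) := by
    refine (hf3 k).congr (ae_of_all _ fun x => ?_)
    show ‖f x‖ ^ 3 = (‖f x‖ ^ 2) ^ (3 / 2 : ℝ)
    rw [← Real.rpow_natCast (‖f x‖) 2, ← Real.rpow_mul (norm_nonneg _)]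
    norm_num
  obtain ⟨-, hle⟩ := holder_three_threeHalves (μ := volume.restrict A) (f := fun _ => (1 : ℝ))
    (g := fun x => ‖f x‖ ^ 2) (fun _ => zero_le_one) (fun _ => by positivity)
    aestronglyMeasurable_const (hfm.norm.pow 2).restrict (integrable_const _) hg32
  have hI3 : ∫ x in A, (‖f x‖ ^ 2) ^ (3 / 2 : ℝ) = ∫ x in A, ‖f x‖ ^ 3 := by
    refine integral_congr_ae (ae_of_all _ fun x => ?_)
    show (‖f x‖ ^ 2) ^ (3 / 2 : ℝ) = ‖f x‖ ^ 3
    rw [← Real.rpow_natCast (‖f x‖) 2, ← Real.rpow_mul (norm_nonneg _)]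
    norm_num
  have hvol : ∫ _ in A, (1 : ℝ) ^ 3 = (lam ^ k) ^ 3 * v₀ := by
    simp only [one_pow, integral_const, smul_eq_mul, mul_one, measureReal_restrict_apply_univ]
    exact volume_real_shell_pow hlam0 k
  simp only [one_mul] at hle
  rw [hI3, hvol] at hle
  -- `((λ^k)^3 v₀)^{1/3} = λ^k v₀^{1/3}`
  have hroot : ((lam ^ k) ^ 3 * v₀) ^ (1 / 3 : ℝ) = lam ^ k * v₀ ^ (1 / 3 : ℝ) := by
    rw [Real.mul_rpow (by positivity) hv₀0, ← Real.rpow_natCast (lam ^ k) 3,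
      ← Real.rpow_mul hLk.le]
    norm_num
  rw [hroot] at hle
  -- assemble
  calc (lam ^ k) ^ (-(5 / 3 : ℝ)) * ∫ x in A, ‖f x‖ ^ 2
      ≤ (lam ^ k) ^ (-(5 / 3 : ℝ)) * (lam ^ k * v₀ ^ (1 / 3 : ℝ) * (∫ x in A, ‖f x‖ ^ 3) ^ (2 / 3 : ℝ)) :=
        mul_le_mul_of_nonneg_left hle (Real.rpow_nonneg hLk.le _)
    _ = v₀ ^ (1 / 3 : ℝ) * ((lam ^ k)⁻¹ * ∫ x in A, ‖f x‖ ^ 3) ^ (2 / 3 : ℝ) := by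
        rw [Real.mul_rpow (inv_nonneg.2 hLk.le) hI0, Real.inv_rpow hLk.le,
          ← Real.rpow_neg hLk.le]
        have h53 : (lam ^ k) ^ (-(5 / 3 : ℝ)) * lam ^ k = (lam ^ k) ^ (-(2 / 3 : ℝ)) := by
          conv_lhs => rw [← Real.rpow_one (lam ^ k), ← Real.rpow_mul hLk.le, ← Real.rpow_add hLk]
          norm_num
        calc (lam ^ k) ^ (-(5 / 3 : ℝ)) * (lam ^ k * v₀ ^ (1 / 3 : ℝ) * (∫ x in A, ‖f x‖ ^ 3) ^ (2 / 3 : ℝ))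
            = ((lam ^ k) ^ (-(5 / 3 : ℝ)) * lam ^ k) * v₀ ^ (1 / 3 : ℝ) *
                (∫ x in A, ‖f x‖ ^ 3) ^ (2 / 3 : ℝ) := by ring
          _ = v₀ ^ (1 / 3 : ℝ) * ((lam ^ k) ^ (-(2 / 3 : ℝ)) * (∫ x in A, ‖f x‖ ^ 3) ^ (2 / 3 : ℝ)) := by
                rw [h53]; ring

/-- **An `L³ × L^{3/2}`-fed cone is an inward point-flux cone of strength exactly `D`.** Under the
hypotheses of `fedCone_smoothFlux_eq_dissipation` (steady smooth unit-viscosity Navier–Stokes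
`(Q, P)` with the `R^{5/3}` envelope and `D = ∫ |∇Q|²`, asymptotic on the shells `λ^k < ‖x‖ < λ^{k+1}`
to the discretely self-similar pair `(V, Π)` in `L³` and, for the pressure, `L^{3/2}` — the `L²`
matching of `CascadeSoliton` and `‖V‖² ∈ L¹_loc` follow, `tendsto_shellL2_of_shellL3`,
`locallyIntegrableOn_normSq_of_cube`), the
sharp log-mean energy flux of the cone through the fundamental shell is
`∫_{1<‖x‖<λ} (½‖V‖² + Π) ⟪V, x⟫/‖x‖² = −D log λ`:
exactly the point-flux law of `PointFluxCone` with `ε = D`, inward. In particular a cascade soliton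
in the sense of `CascadeSoliton` whose cone is fed in `L³ × L^{3/2}` can only be fed by a cone that
swallows energy at rate `D > 0` at the apex at infinity — never by a fluxless cone.
(`fedCone_smoothFlux_eq_dissipation` for the radial cutoffs `G(‖x‖²/c²)`, `c ∈ [1, λ]`, then
`logMeanFlux_eq_of_constantSmoothFlux`.) [folklore] -/
theorem fedCone_logMeanFlux_eq {Q : EuclideanSpace ℝ (Fin 3) → EuclideanSpace ℝ (Fin 3)} {P : EuclideanSpace ℝ (Fin 3) → ℝ}
    (hNS : IsClassicalNSSolutionOn Set.univ 1 (fun _ _ => 0) (fun _ => Q) (fun _ => P))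
    (hmass : ∃ C : ℝ, ∀ R : ℝ, 1 ≤ R → ∫ x in ball (0 : EuclideanSpace ℝ (Fin 3)) R, ‖Q x‖ ^ 2 ≤ C * R ^ (5 / 3 : ℝ))
    (hDint : Integrable (fun x => frobeniusNormSq (fderiv ℝ Q x)))
    {lam : ℝ} {V : EuclideanSpace ℝ (Fin 3) → EuclideanSpace ℝ (Fin 3)} {Pc : EuclideanSpace ℝ (Fin 3) → ℝ} (hlam : 1 < lam)
    (hVm : AEStronglyMeasurable V volume) (hPcm : AEStronglyMeasurable Pc volume)
    (hV : ∀ x : EuclideanSpace ℝ (Fin 3), x ≠ 0 → V (lam • x) = lam ^ (-(2 / 3 : ℝ)) • V x)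
    (hPc : ∀ x : EuclideanSpace ℝ (Fin 3), x ≠ 0 → Pc (lam • x) = lam ^ (-(4 / 3 : ℝ)) * Pc x)
    (hV3 : LocallyIntegrableOn (fun x => ‖V x‖ ^ 3) {x : EuclideanSpace ℝ (Fin 3) | x ≠ 0} volume)
    (hPc32 : LocallyIntegrableOn (fun x => |Pc x| ^ (3 / 2 : ℝ)) {x : EuclideanSpace ℝ (Fin 3) | x ≠ 0} volume)
    (hL3 : Tendsto (fun k : ℕ => (lam ^ k)⁻¹ *
      ∫ x in {x : EuclideanSpace ℝ (Fin 3) | lam ^ k < ‖x‖ ∧ ‖x‖ < lam ^ (k + 1)}, ‖Q x - V x‖ ^ 3) atTop (𝓝 0))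
    (hP32 : Tendsto (fun k : ℕ => (lam ^ k)⁻¹ *
      ∫ x in {x : EuclideanSpace ℝ (Fin 3) | lam ^ k < ‖x‖ ∧ ‖x‖ < lam ^ (k + 1)}, |P x - Pc x| ^ (3 / 2 : ℝ))
      atTop (𝓝 0)) :
    ∫ x in {x : EuclideanSpace ℝ (Fin 3) | 1 < ‖x‖ ∧ ‖x‖ < lam}, (‖V x‖ ^ 2 / 2 + Pc x) * (⟪V x, x⟫_ℝ / ‖x‖ ^ 2) =
      -((∫ x, frobeniusNormSq (fderiv ℝ Q x)) * Real.log lam) := by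
  have hlam0 : 0 < lam := one_pos.trans hlam
  have hV2 := locallyIntegrableOn_normSq_of_cube hVm hV3
  have hQc : Continuous Q := (hNS.contDiff_velocity (Set.mem_univ (0 : ℝ))).continuous
  have hL2 := tendsto_shellL2_of_shellL3 hlam (hQc.aestronglyMeasurable.sub hVm)
    (fun k => integrableOn_cubicDefect_shell hQc hVm hV3 (pow_pos hlam0 k) _) hL3
  have hr : 1 < (2 + lam) / 3 := by linarith
  have hrb : (2 + lam) / 3 < (1 + 2 * lam) / 3 := by linarith
  have hb : (1 + 2 * lam) / 3 < lam := by linarith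
  have hb0 : 0 < (1 + 2 * lam) / 3 := by linarith
  have hρ : ((2 + lam) / 3) ^ 2 < ((1 + 2 * lam) / 3) ^ 2 := by nlinarith
  obtain ⟨G, hGs, hG1, hG0⟩ := exists_smoothProfile hρ
  have hGd : Differentiable ℝ G := hGs.differentiable (by simp)
  have hT : ∀ c ∈ Icc 1 lam, ∫ x, (2⁻¹ * ‖V x‖ ^ 2 + Pc x) *
      (deriv G (‖x‖ ^ 2 / c ^ 2) *
        ((c ^ 2)⁻¹ * (2 * ⟪x, V x⟫_ℝ))) = ∫ x, frobeniusNormSq (fderiv ℝ Q x) := by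
    intro c hc
    have hc0 : 0 < c := one_pos.trans_le hc.1
    have hψs : ContDiff ℝ ∞ (fun y : EuclideanSpace ℝ (Fin 3) => G (‖y‖ ^ 2 / c ^ 2)) :=
      hGs.comp ((contDiff_norm_sq ℝ).div_const _)
    have hψ1 : ∀ x : EuclideanSpace ℝ (Fin 3), ‖x‖ < (2 + lam) / 3 →
        G (‖x‖ ^ 2 / c ^ 2) = 1 :=
      fun x hx => hG1 _ (by
        rw [div_le_iff₀ (by positivity)]
        have h1 : ‖x‖ ≤ (2 + lam) / 3 * c :=
          hx.le.trans (le_mul_of_one_le_right (by positivity) hc.1)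
        calc ‖x‖ ^ 2 ≤ ((2 + lam) / 3 * c) ^ 2 := pow_le_pow_left₀ (norm_nonneg _) h1 2
          _ = ((2 + lam) / 3) ^ 2 * c ^ 2 := by ring)
    have hψ0 : ∀ x : EuclideanSpace ℝ (Fin 3), c * ((1 + 2 * lam) / 3) < ‖x‖ →
        G (‖x‖ ^ 2 / c ^ 2) = 0 :=
      fun x hx => hG0 _ (by
        rw [le_div_iff₀ (by positivity)]
        calc ((1 + 2 * lam) / 3) ^ 2 * c ^ 2 = (c * ((1 + 2 * lam) / 3)) ^ 2 := by ring
          _ ≤ ‖x‖ ^ 2 := pow_le_pow_left₀ (by positivity) hx.le 2)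
    have hcb : c * ((1 + 2 * lam) / 3) < lam ^ 2 := by
      calc c * ((1 + 2 * lam) / 3) ≤ lam * ((1 + 2 * lam) / 3) :=
            mul_le_mul_of_nonneg_right hc.2 hb0.le
        _ < lam * lam := mul_lt_mul_of_pos_left hb hlam0
        _ = lam ^ 2 := (sq lam).symm
    rw [← fedCone_smoothFlux_eq_dissipation hNS hmass hDint hlam hVm hPcm hV hPc hV2 hV3 hPc32 hL2
      hL3 hP32 hψs hr hcb hψ1 hψ0]
    refine integral_congr_ae (ae_of_all _ fun x => ?_)
    simp only
    rw [fderiv_radialCutoff_apply hGd c x (V x)]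
  rw [← logMeanFlux_eq_of_constantSmoothFlux hlam hVm hPcm hV hPc hV3 hPc32 hr hrb hb.le hGs hG1
    hG0 hT]
  refine setIntegral_congr_fun (measurableSet_shell 1 lam) fun x _ => ?_
  ring

/-- A field continuous off the (Lebesgue-null) origin is a.e.-strongly measurable. [folklore] -/
theorem aestronglyMeasurable_of_continuousOn_ne {F : Type*} [NormedAddCommGroup F]
    [NormedSpace ℝ F] [SecondCountableTopology F] {f : EuclideanSpace ℝ (Fin 3) → F}
    (hf : ContinuousOn f {x : EuclideanSpace ℝ (Fin 3) | x ≠ 0}) : AEStronglyMeasurable f volume := by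
  have h := hf.aestronglyMeasurable (μ := volume) isOpen_ne.measurableSet
  rwa [show {x : EuclideanSpace ℝ (Fin 3) | x ≠ 0} = {0}ᶜ from rfl, restrict_compl_singleton] at h

/-- **Corollary 1: no `C¹` Euler cone can feed a cascade soliton in `L³ × L^{3/2}`.** There is no
smooth steady unit-viscosity Navier–Stokes solution with the `R^{5/3}` envelope and dissipation
`D > 0` that is asymptotic in `L²`, `L³` (velocity) and `L^{3/2}` (pressure) on the shells
`λ^k < ‖x‖ < λ^{k+1}` to a discretely self-similar pair `(V, Π)` that is `C¹` off the origin and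
solves steady Euler there classically: such a cone is fluxless (`stub_c1ConeFluxless`, the smooth
form of Shvydkoy's homogeneous-Euler flux law), while a fed cone must swallow `D log λ > 0` per
fundamental shell (`fedCone_logMeanFlux_eq`). This kills the `CascadeSoliton` picture for every
classical self-similar far field (Landau-type or smooth DSS profiles), unconditionally. [folklore] -/
theorem not_cascadeSoliton_L3fedBy_c1EulerCone :
    ¬ ∃ (Q : EuclideanSpace ℝ (Fin 3) → EuclideanSpace ℝ (Fin 3)) (P : EuclideanSpace ℝ (Fin 3) → ℝ),
      IsClassicalNSSolutionOn Set.univ 1 (fun _ _ => 0) (fun _ => Q) (fun _ => P) ∧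
      (∃ C : ℝ, ∀ R : ℝ, 1 ≤ R → ∫ x in ball (0 : EuclideanSpace ℝ (Fin 3)) R, ‖Q x‖ ^ 2 ≤ C * R ^ (5 / 3 : ℝ)) ∧
      Integrable (fun x => frobeniusNormSq (fderiv ℝ Q x)) ∧
      0 < ∫ x, frobeniusNormSq (fderiv ℝ Q x) ∧
      ∃ (lam : ℝ) (V : EuclideanSpace ℝ (Fin 3) → EuclideanSpace ℝ (Fin 3)) (Pc : EuclideanSpace ℝ (Fin 3) → ℝ), 1 < lam ∧
        ContDiffOn ℝ 1 V {x : EuclideanSpace ℝ (Fin 3) | x ≠ 0} ∧ ContDiffOn ℝ 1 Pc {x : EuclideanSpace ℝ (Fin 3) | x ≠ 0} ∧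
        (∀ x : EuclideanSpace ℝ (Fin 3), x ≠ 0 → V (lam • x) = lam ^ (-(2 / 3 : ℝ)) • V x) ∧
        (∀ x : EuclideanSpace ℝ (Fin 3), x ≠ 0 → Pc (lam • x) = lam ^ (-(4 / 3 : ℝ)) * Pc x) ∧
        (∀ x : EuclideanSpace ℝ (Fin 3), x ≠ 0 → convect V V x + gradient Pc x = 0) ∧
        (∀ x : EuclideanSpace ℝ (Fin 3), x ≠ 0 → VectorCalculus.divergence V x = 0) ∧
        Tendsto (fun k : ℕ => (lam ^ k)⁻¹ *
          ∫ x in {x : EuclideanSpace ℝ (Fin 3) | lam ^ k < ‖x‖ ∧ ‖x‖ < lam ^ (k + 1)}, ‖Q x - V x‖ ^ 3) atTop (𝓝 0) ∧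
        Tendsto (fun k : ℕ => (lam ^ k)⁻¹ *
          ∫ x in {x : EuclideanSpace ℝ (Fin 3) | lam ^ k < ‖x‖ ∧ ‖x‖ < lam ^ (k + 1)}, |P x - Pc x| ^ (3 / 2 : ℝ))
          atTop (𝓝 0) := by
  rintro ⟨Q, P, hNS, hmass, hDint, hDpos, lam, V, Pc, hlam, hVc1, hPc1, hV, hPc, hE, hdiv, hL3, hP32⟩
  have hU : MeasurableSet {x : EuclideanSpace ℝ (Fin 3) | x ≠ 0} := isOpen_ne.measurableSet
  have hVc : ContinuousOn V {x : EuclideanSpace ℝ (Fin 3) | x ≠ 0} := hVc1.continuousOn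
  have hPcc : ContinuousOn Pc {x : EuclideanSpace ℝ (Fin 3) | x ≠ 0} := hPc1.continuousOn
  have hVm : AEStronglyMeasurable V volume := aestronglyMeasurable_of_continuousOn_ne hVc
  have hPcm : AEStronglyMeasurable Pc volume := aestronglyMeasurable_of_continuousOn_ne hPcc
  have hV3 : LocallyIntegrableOn (fun x => ‖V x‖ ^ 3) {x : EuclideanSpace ℝ (Fin 3) | x ≠ 0} volume :=
    (hVc.norm.pow 3).locallyIntegrableOn hU
  have hPc32 : LocallyIntegrableOn (fun x => |Pc x| ^ (3 / 2 : ℝ)) {x : EuclideanSpace ℝ (Fin 3) | x ≠ 0} volume :=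
    ((continuous_abs.comp_continuousOn hPcc).rpow_const fun x _ => Or.inr (by norm_num))
      |>.locallyIntegrableOn hU
  have h1 := fedCone_logMeanFlux_eq hNS hmass hDint hlam hVm hPcm hV hPc hV3 hPc32 hL3 hP32
  have h2 := stub_c1ConeFluxless lam V Pc hlam hVc1 hPc1 hV hPc hE hdiv
  have h3 : 0 < (∫ x, frobeniusNormSq (fderiv ℝ Q x)) * Real.log lam :=
    mul_pos hDpos (Real.log_pos hlam)
  linarith

/-- `|Π| ≤ 1 + |Π|^{3/2}`, so `|Π|^{3/2} ∈ L¹_loc(ℝ³∖0)` gives `Π ∈ L¹_loc(ℝ³∖0)`. [folklore] -/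
theorem locallyIntegrableOn_of_rpow_threeHalves {Pc : EuclideanSpace ℝ (Fin 3) → ℝ}
    (hPcm : AEStronglyMeasurable Pc volume)
    (hPc32 : LocallyIntegrableOn (fun x => |Pc x| ^ (3 / 2 : ℝ)) {x : EuclideanSpace ℝ (Fin 3) | x ≠ 0} volume) :
    LocallyIntegrableOn Pc {x : EuclideanSpace ℝ (Fin 3) | x ≠ 0} volume := by
  intro x hx
  obtain ⟨U, hU, hint⟩ := hPc32 x hx
  refine ⟨U ∩ ball x 1, Filter.inter_mem hU (mem_nhdsWithin_of_mem_nhds (ball_mem_nhds x one_pos)), ?_⟩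
  have hfin : volume (U ∩ ball x 1) < ⊤ :=
    (Metric.isBounded_ball.subset Set.inter_subset_right).measure_lt_top
  haveI : IsFiniteMeasure (volume.restrict (U ∩ ball x 1)) := ⟨by rwa [Measure.restrict_apply_univ]⟩
  have hW32 : IntegrableOn (fun x => |Pc x| ^ (3 / 2 : ℝ)) (U ∩ ball x 1) volume :=
    hint.mono_set Set.inter_subset_left
  refine Integrable.mono' ((integrable_const (1 : ℝ)).add hW32) hPcm.restrict
    (Eventually.of_forall fun y => ?_)
  rw [Real.norm_eq_abs]
  show |Pc y| ≤ 1 + |Pc y| ^ (3 / 2 : ℝ)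
  rcases le_or_gt |Pc y| 1 with h | h
  · linarith [Real.rpow_nonneg (abs_nonneg (Pc y)) (3 / 2 : ℝ)]
  · have : |Pc y| ≤ |Pc y| ^ (3 / 2 : ℝ) := by
      calc |Pc y| = |Pc y| ^ (1 : ℝ) := (Real.rpow_one _).symm
        _ ≤ |Pc y| ^ (3 / 2 : ℝ) := Real.rpow_le_rpow_of_exponent_le h.le (by norm_num)
    linarith

/-- The sharp flux density `(½‖V‖² + Π) ⟪V, x⟫/‖x‖²` of a cone with `‖V‖³, |Π|^{3/2} ∈ L¹_loc(ℝ³∖0)`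
is integrable on the fundamental shell. [folklore] -/
theorem integrableOn_fluxDensity_shell {V : EuclideanSpace ℝ (Fin 3) → EuclideanSpace ℝ (Fin 3)} {Pc : EuclideanSpace ℝ (Fin 3) → ℝ}
    (hVm : AEStronglyMeasurable V volume) (hPcm : AEStronglyMeasurable Pc volume)
    (hV3 : LocallyIntegrableOn (fun x => ‖V x‖ ^ 3) {x : EuclideanSpace ℝ (Fin 3) | x ≠ 0} volume)
    (hPc32 : LocallyIntegrableOn (fun x => |Pc x| ^ (3 / 2 : ℝ)) {x : EuclideanSpace ℝ (Fin 3) | x ≠ 0} volume)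
    (lam : ℝ) :
    IntegrableOn (fun x => (‖V x‖ ^ 2 / 2 + Pc x) * (⟪V x, x⟫_ℝ / ‖x‖ ^ 2))
      {x : EuclideanSpace ℝ (Fin 3) | 1 < ‖x‖ ∧ ‖x‖ < lam} volume := by
  have hA'm : MeasurableSet {x : EuclideanSpace ℝ (Fin 3) | 1 ≤ ‖x‖ ∧ ‖x‖ ≤ lam} :=
    (isCompact_shell 1 lam).measurableSet
  have hHV := integrableOn_absHead_mul_norm hVm hPcm hV3 hPc32 one_pos lam
  have hm : AEStronglyMeasurable (fun x => (‖V x‖ ^ 2 / 2 + Pc x) * (⟪V x, x⟫_ℝ / ‖x‖ ^ 2))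
      volume :=
    ((((hVm.norm.aemeasurable.pow_const 2).div_const 2).add hPcm.aemeasurable).mul
      ((hVm.aemeasurable.inner aemeasurable_id).div
        (measurable_norm.pow_const 2).aemeasurable)).aestronglyMeasurable
  have hcl : IntegrableOn (fun x => (‖V x‖ ^ 2 / 2 + Pc x) * (⟪V x, x⟫_ℝ / ‖x‖ ^ 2))
      {x : EuclideanSpace ℝ (Fin 3) | 1 ≤ ‖x‖ ∧ ‖x‖ ≤ lam} volume := by
    refine Integrable.mono' hHV hm.restrict ((ae_restrict_mem hA'm).mono fun x hx => ?_)
    have hx1 : 1 ≤ ‖x‖ := hx.1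
    rw [Real.norm_eq_abs, abs_mul, abs_div, abs_of_nonneg (by positivity : (0 : ℝ) ≤ ‖x‖ ^ 2),
      show ‖V x‖ ^ 2 / 2 + Pc x = 2⁻¹ * ‖V x‖ ^ 2 + Pc x by ring]
    refine mul_le_mul_of_nonneg_left ?_ (abs_nonneg _)
    rw [div_le_iff₀ (by positivity)]
    calc |⟪V x, x⟫_ℝ| ≤ ‖V x‖ * ‖x‖ := abs_real_inner_le_norm _ _
      _ ≤ ‖V x‖ * ‖x‖ ^ 2 := by
        refine mul_le_mul_of_nonneg_left ?_ (norm_nonneg _)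
        nlinarith
  exact hcl.mono_set fun x hx => ⟨hx.1.le, hx.2.le⟩

/-- **Corollary 2: no renormalised cone can feed a cascade soliton in `L³ × L^{3/2}`.** The same
conclusion for measurable discretely self-similar cones `(V, Π)` (`‖V‖², ‖V‖³, |Π|^{3/2} ∈ L¹_loc` off
the origin) satisfying the renormalised local energy balance off the origin
(`div(β(½‖V‖²+Π) V) = 0` in `𝒟'(ℝ³∖0)` for all `C¹` bounded-slope `β` with `β(0) = 0` — automatic for
weak Euler cones obtained as strong `L³_loc` limits, DiPerna–Lions): such cones are fluxless by
`stub_dssFluxRigidity`, contradicting `fedCone_logMeanFlux_eq`. Hence the cone of a genuine cascade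
soliton must be an *irregular* dissipative Euler solution on `ℝ³∖0` (Onsager-supercritical
renormalisation defect off the apex), not merely singular at the apex. [folklore] -/
theorem not_cascadeSoliton_L3fedBy_renormalisedCone :
    ¬ ∃ (Q : EuclideanSpace ℝ (Fin 3) → EuclideanSpace ℝ (Fin 3)) (P : EuclideanSpace ℝ (Fin 3) → ℝ),
      IsClassicalNSSolutionOn Set.univ 1 (fun _ _ => 0) (fun _ => Q) (fun _ => P) ∧
      (∃ C : ℝ, ∀ R : ℝ, 1 ≤ R → ∫ x in ball (0 : EuclideanSpace ℝ (Fin 3)) R, ‖Q x‖ ^ 2 ≤ C * R ^ (5 / 3 : ℝ)) ∧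
      Integrable (fun x => frobeniusNormSq (fderiv ℝ Q x)) ∧
      0 < ∫ x, frobeniusNormSq (fderiv ℝ Q x) ∧
      ∃ (lam : ℝ) (V : EuclideanSpace ℝ (Fin 3) → EuclideanSpace ℝ (Fin 3)) (Pc : EuclideanSpace ℝ (Fin 3) → ℝ), 1 < lam ∧
        AEStronglyMeasurable V volume ∧ AEStronglyMeasurable Pc volume ∧
        (∀ x : EuclideanSpace ℝ (Fin 3), x ≠ 0 → V (lam • x) = lam ^ (-(2 / 3 : ℝ)) • V x) ∧
        (∀ x : EuclideanSpace ℝ (Fin 3), x ≠ 0 → Pc (lam • x) = lam ^ (-(4 / 3 : ℝ)) * Pc x) ∧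
        LocallyIntegrableOn (fun x => ‖V x‖ ^ 3) {x : EuclideanSpace ℝ (Fin 3) | x ≠ 0} volume ∧
        LocallyIntegrableOn (fun x => |Pc x| ^ (3 / 2 : ℝ)) {x : EuclideanSpace ℝ (Fin 3) | x ≠ 0} volume ∧
        (∀ β : ℝ → ℝ, ContDiff ℝ 1 β → (∃ Cβ : ℝ, ∀ t : ℝ, ‖deriv β t‖ ≤ Cβ) → β 0 = 0 →
          ∀ θ : EuclideanSpace ℝ (Fin 3) → ℝ, IsTestFunctionOn ⟨{x : EuclideanSpace ℝ (Fin 3) | x ≠ 0}, isOpen_ne⟩ θ →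
            ∫ x, β (‖V x‖ ^ 2 / 2 + Pc x) * ⟪V x, gradient θ x⟫_ℝ = 0) ∧
        Tendsto (fun k : ℕ => (lam ^ k)⁻¹ *
          ∫ x in {x : EuclideanSpace ℝ (Fin 3) | lam ^ k < ‖x‖ ∧ ‖x‖ < lam ^ (k + 1)}, ‖Q x - V x‖ ^ 3) atTop (𝓝 0) ∧
        Tendsto (fun k : ℕ => (lam ^ k)⁻¹ *
          ∫ x in {x : EuclideanSpace ℝ (Fin 3) | lam ^ k < ‖x‖ ∧ ‖x‖ < lam ^ (k + 1)}, |P x - Pc x| ^ (3 / 2 : ℝ))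
          atTop (𝓝 0) := by
  rintro ⟨Q, P, hNS, hmass, hDint, hDpos, lam, V, Pc, hlam, hVm, hPcm, hV, hPc, hV3, hPc32, hren, hL3,
    hP32⟩
  have h1 := fedCone_logMeanFlux_eq hNS hmass hDint hlam hVm hPcm hV hPc hV3 hPc32 hL3 hP32
  have h2 := stub_dssFluxRigidity lam V Pc hlam hVm hV hPc (locallyIntegrableOn_normSq_of_cube hVm hV3)
    (locallyIntegrableOn_of_rpow_threeHalves hPcm hPc32) hren
    (integrableOn_fluxDensity_shell hVm hPcm hV3 hPc32 lam)
  have h3 : 0 < (∫ x, frobeniusNormSq (fderiv ℝ Q x)) * Real.log lam :=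
    mul_pos hDpos (Real.log_pos hlam)
  linarith

end Summit.AnomalousDissipation.AnomalousDissipation.Theorems.ConeDesingularisation.Negative
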